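import Mathlib
import Literature.Computability.AlgebraicComplexity.ReadKDeterminantalRepresentationsProofs
import Literature.Computability.AlgebraicComplexity.BLMW11ApproximationProjections
import Summits.ValiantsHypothesis.ValiantsHypothesis.Theorems.PrincipalMinorColouringBorderBoundedRankTwoDefs

/-!
# Route PrincipalMinorColouring — crux `BorderBoundedRankTwo` (stmt-ValiantsHypothesis-21038), line
# `closure_counting`: stub `stub_transport` LANDED — closure transport to the normal-form image

Registered stub `stub_transport` of `Cruxes/BorderBoundedRankTwo/Lines/closure_counting.lean` (val-width-lines-2;
T6 rung `r = 2` of `BorderBoundedRank`, stmt-3778), BY NAME AND SIGNATURE, over the line's vocabulary `monB` /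
`nfMap` / `NFImage` (`…PrincipalMinorColouringBorderBoundedRankTwoDefs.lean`, verbatim the skeleton's): if the
coefficient function of `per_n(x+J)` lies in the closure (product topology on `((Fin n × Fin n) →₀ ℕ) → ℂ`) of the
coefficient functions of the principal-minor expressions `n! · det (I_R + diag(x ∘ κ) K)`, `K ∈ ℂ^{R×R}`, with
colour classes of `κ` of size `≤ 2`, then for every injective placement `ζ` of `k` variables and every
substitution `S` of constants outside `ζ` with `S(per_n) = Σ_h c_h ∏_{h i} X_{ζ i}`, the coefficient family `c`
lies in `closure (NFImage k)` — the closure of the union over `s ≤ 2k` slot patterns of the images of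
Hrubeš–Joglekar's normal-form coefficient maps `(a, H) ↦ coeffs (a · det (diag(X_ι, 0) + H))`.  The skeleton's
`sorry` is replaced by `exact Summit.ValiantsHypothesis.ValiantsHypothesis.Theorems.BorderBoundedRankTwoClosureCounting.stub_transport`.

## Proof ("images pass to closures")

* `coeff_linearMap_mem_closure` — closure transport under a linear map on bounded supports: if every member of
  `S` is supported in a finite set `B` of monomials, the closed subspace `{v | v = 0 off B}` contains
  `closure (coeff '' S)`, and on it `g ↦ (coeff_{mon i} (L g))_i` is a FINITE sum of coordinate functionals
  (`coeff_linearMap_eq_sum_of_support_subset`), hence continuous for the product topology, so `map_mem_closure`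
  applies.  Here `L = aeval T` with `T : X_{ζ i} ↦ X_i - 1`, `x_e ↦ S(e) - 1` otherwise, and `B` = the monomials
  of degree `≤ R` (`support_approximant_subset`: the approximants have total degree `≤ R`).
* `coeff_det_one_add_diagonal_mul_mem_NFImage` — `T` of an approximant is `n! · det (1 + diag(d) K)` with
  `d_j = β_j + [κ j = ζ i] X_i`; bordering once, `det (1 + diag(d) K) = det [[1, diag d], [-K, 1]]`
  (`Matrix.det_fromBlocks_one₂₂`), puts the at most `2k` variable occurrences at positions `(inl j, inr j)` of a
  constant matrix, and Hrubeš–Joglekar 2025, Lemma 1 (`exists_det_eq_const_mul_det_normalForm`, tree) rewrites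
  the determinant as `c · det (diag(X_ι, 0) + H)`, i.e. a point of `NFImage k`.
* `rename ζ (T P) = S(per_n)` (undo the shift `x ↦ x + J`, `comp_aeval`) identifies the limit's multilinear
  coefficients with `c` (`coeff_rename_mapDomain`, `coeff_sum_C_mul_prod_ite_X`).

No new definitions, no named facts; axioms `propext`, `Classical.choice`, `Quot.sound`.  With the line's second
stub `stub_denseCount` (dense-image counting, open in the skeleton) the composition `BorderBoundedRankTwo_of`
closes the crux.  VP ≠ VNP is not moved by this file: the rung is a border form of a bounded-colour-class
impossibility (Hrubeš–Joglekar's read-`k` range); the route's open content (TotalRankNotQP) is untouched.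

## References
* P. Hrubeš, P. S. Joglekar, *On read-k projections of the determinant*, STACS 2025, LIPIcs 327, Art. 53,
  Lemma 1 (p. 53:3), Thm. 2 (p. 53:4), Thm. 7 / Cor. 8 (p. 53:6). [HrubesJoglekar2025]
* P. Bürgisser, J. M. Landsberg, L. Manivel, J. Weyman, *An overview of mathematical issues arising in the
  geometric complexity theory approach to VP ≠ VNP*, SIAM J. Comput. 40 (2011), §9.3 (closures inside the
  finite-dimensional pieces `{deg ≤ d}`). [BurgisserEtAl2011]
-/

noncomputable section

-- `Summit.ValiantsHypothesis.ValiantsHypothesis.…` is the tree's single-conjunct layout (Sub = Summit).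
set_option linter.dupNamespace false

namespace Summit.ValiantsHypothesis.ValiantsHypothesis.Theorems.BorderBoundedRankTwoClosureCounting

open MvPolynomial Matrix
open Literature.Computability.AlgebraicComplexity

/-- **Closure transport under a linear map on bounded supports (Euclidean / product topology).**
Let `S` be a set of polynomials over `ℂ` all supported in a finite set `B` of monomials, `L` a `ℂ`-linear map
of polynomial rings and `mon : ι → (τ →₀ ℕ)` a family of target monomials. If the coefficient function of
`f` is in the closure (product topology) of the coefficient functions of `S`, and the `mon`-coefficients of
`L g` lie in `U` for every `g ∈ S`, then the `mon`-coefficients of `L f` lie in `closure U`: on supports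
`⊆ B` the map `g ↦ (coeff (mon i) (L g))_i` is the restriction of a finite sum of coordinate functionals,
hence continuous, and the closed subspace of functions vanishing off `B` contains the closure.
[cite: BurgisserEtAl2011, §9.3 (remark after Def. 9.3.1)] -/
theorem coeff_linearMap_mem_closure {σ τ ι : Type*} (L : MvPolynomial σ ℂ →ₗ[ℂ] MvPolynomial τ ℂ)
    (mon : ι → (τ →₀ ℕ)) {S : Set (MvPolynomial σ ℂ)} {B : Finset (σ →₀ ℕ)}
    (hS : ∀ g ∈ S, g.support ⊆ B) {f : MvPolynomial σ ℂ}
    (hf : (fun m => coeff m f) ∈ closure ((fun g : MvPolynomial σ ℂ => fun m => coeff m g) '' S))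
    {U : Set (ι → ℂ)} (hU : ∀ g ∈ S, (fun i => coeff (mon i) (L g)) ∈ U) :
    f.support ⊆ B ∧ (fun i => coeff (mon i) (L f)) ∈ closure U := by
  classical
  -- the closed subspace of coefficient functions vanishing off `B`
  set V : Set ((σ →₀ ℕ) → ℂ) := {v | ∀ m, m ∉ B → v m = 0} with hV
  have hVclosed : IsClosed V := by
    simp only [hV, Set.setOf_forall]
    exact isClosed_iInter fun m => isClosed_iInter fun _ =>
      isClosed_eq (continuous_apply m) continuous_const
  have hSV : (fun g : MvPolynomial σ ℂ => fun m => coeff m g) '' S ⊆ V := by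
    rintro _ ⟨g, hg, rfl⟩ m hm
    exact notMem_support_iff.mp fun h => hm (hS g hg h)
  have hfV : (fun m => coeff m f) ∈ V := closure_minimal hSV hVclosed hf
  have hfB : f.support ⊆ B := fun m hm => by
    by_contra hmB
    exact (mem_support_iff.mp hm) (hfV m hmB)
  refine ⟨hfB, ?_⟩
  -- the continuous functional
  set Λ : ((σ →₀ ℕ) → ℂ) → (ι → ℂ) :=
    fun v i => ∑ m ∈ B, v m * coeff (mon i) (L (monomial m 1)) with hΛ
  have hΛcont : Continuous Λ :=
    continuous_pi fun i => continuous_finsetSum _ fun m _ =>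
      (continuous_apply m).mul continuous_const
  have hΛg : ∀ g : MvPolynomial σ ℂ, g.support ⊆ B →
      Λ (fun m => coeff m g) = fun i => coeff (mon i) (L g) := by
    intro g hg
    funext i
    rw [hΛ, coeff_linearMap_eq_sum_of_support_subset L hg]
  rw [← hΛg f hfB]
  refine map_mem_closure hΛcont hf ?_
  rintro _ ⟨g, hg, rfl⟩
  rw [hΛg g (hS g hg)]
  exact hU g hg

/-- **The approximants in normal form.** For a constant matrix `K`, constants `β`, and variable slots
`slot : Q → Fin R` filled with the variables `X (ι q)` (at most `2k` of them), the `2^k` multilinear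
coefficients of `a · det (1 + diag(d) · K)`, `d j = β j + ∑_{slot q = j} X_{ι q}`, lie in `NFImage k`: border the
matrix once (`det (1 + diag(d) K) = det [[1, diag d], [-K, 1]]`, `Matrix.det_fromBlocks_one₂₂`), so that the
variables sit at the `|Q|` positions `(inl j, inr j)`, and apply Hrubeš–Joglekar's Lemma 1
(`exists_det_eq_const_mul_det_normalForm`). [cite: HrubesJoglekar2025, Lemma 1 (p. 53:3)] -/
theorem coeff_det_one_add_diagonal_mul_mem_NFImage {R k : ℕ} {Q : Type*} [Fintype Q]
    (K : Matrix (Fin R) (Fin R) ℂ) (d : Fin R → MvPolynomial (Fin k) ℂ) (β : Fin R → ℂ) (slot : Q → Fin R)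
    (ι : Q → Fin k) (a : ℂ)
    (hd : ∀ j, d j = C (β j) + ∑ q, (if slot q = j then (X (ι q) : MvPolynomial (Fin k) ℂ) else 0))
    (hQ : Fintype.card Q ≤ 2 * k) :
    (fun h : Fin k → Bool => coeff (monB h) (C a *
      (1 + diagonal d * K.map (fun b : ℂ => (C b : MvPolynomial (Fin k) ℂ))).det)) ∈ NFImage k := by
  classical
  set s := Fintype.card Q with hs
  set e : Fin s ≃ Q := (Fintype.equivFin Q).symm with he
  -- constant part and variable positions of the bordered matrix
  set C₀ : Matrix (Fin R ⊕ Fin R) (Fin R ⊕ Fin R) ℂ := fromBlocks 1 (diagonal β) (-K) 1 with hC₀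
  set pos : Fin s → (Fin R ⊕ Fin R) × (Fin R ⊕ Fin R) :=
    fun q => (Sum.inl (slot (e q)), Sum.inr (slot (e q))) with hpos
  set w : Fin s → MvPolynomial (Fin k) ℂ := fun q => X (ι (e q)) with hw
  -- the bordered matrix is `C₀ + ∑_q w_q E_{pos q}`
  have hB : fromBlocks 1 (diagonal d) (-K.map (fun b : ℂ => (C b : MvPolynomial (Fin k) ℂ))) 1 =
      C₀.map (algebraMap ℂ (MvPolynomial (Fin k) ℂ)) +
        ∑ q, w q • Matrix.single (pos q).1 (pos q).2 (1 : MvPolynomial (Fin k) ℂ) := by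
    rw [MvPolynomial.algebraMap_eq]
    refine Matrix.ext fun i j => ?_
    rw [Matrix.add_apply, Matrix.sum_apply]
    simp only [Matrix.smul_apply, Matrix.single_apply, smul_eq_mul, mul_ite, mul_one, mul_zero, hpos]
    rcases i with i | i <;> rcases j with j | j
    · simp [hC₀, Matrix.one_apply]
    · have hsum : (∑ x : Fin s, if Sum.inl (slot (e x)) = (Sum.inl i : Fin R ⊕ Fin R) ∧
          Sum.inr (slot (e x)) = (Sum.inr j : Fin R ⊕ Fin R) then w x else 0) =
          if i = j then ∑ q, (if slot q = j then (X (ι q) : MvPolynomial (Fin k) ℂ) else 0) else 0 := by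
        simp only [Sum.inl.injEq, Sum.inr.injEq, hw]
        rw [Equiv.sum_comp e (fun q => if slot q = i ∧ slot q = j then (X (ι q) : MvPolynomial (Fin k) ℂ) else 0)]
        split_ifs with hij
        · subst hij
          simp only [and_self]
        · exact Finset.sum_eq_zero fun q _ => if_neg fun h' => hij (h'.1.symm.trans h'.2)
      rw [hsum]
      simp only [hC₀, fromBlocks_apply₁₂, Matrix.map_apply, diagonal_apply]
      split_ifs with hij
      · subst hij
        exact hd i
      · simp
    · simp [hC₀]
    · simp [hC₀, Matrix.one_apply]
  have hdet : (1 + diagonal d * K.map (fun b : ℂ => (C b : MvPolynomial (Fin k) ℂ))).det =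
      (fromBlocks 1 (diagonal d) (-K.map (fun b : ℂ => (C b : MvPolynomial (Fin k) ℂ))) 1).det := by
    rw [det_fromBlocks_one₂₂, Matrix.mul_neg, sub_neg_eq_add]
  obtain ⟨c, H, hcH⟩ := Literature.LinearAlgebra.Matrix.exists_det_eq_const_mul_det_normalForm
    (R' := MvPolynomial (Fin k) ℂ) C₀ pos w
  rw [← hB, MvPolynomial.algebraMap_eq] at hcH
  -- membership in the union of images
  simp only [NFImage, Set.mem_iUnion, Set.mem_range]
  refine ⟨⟨s, Nat.lt_succ_of_le hQ⟩, fun q => ι (e q), (a * c, H), ?_⟩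
  funext h
  show coeff (monB h) (C (a * c) * (diagonal (Sum.elim (fun q => (X (ι (e q)) : MvPolynomial (Fin k) ℂ)) 0) +
      H.map (fun b : ℂ => (C b : MvPolynomial (Fin k) ℂ))).det) = coeff (monB h) (C a * (1 + diagonal d *
        K.map (fun b : ℂ => (C b : MvPolynomial (Fin k) ℂ))).det)
  rw [hdet, hcH, ← mul_assoc, ← map_mul]

/-- The determinant of a square matrix of polynomials of total degree `≤ 1` has total degree at most the
size of the matrix (Leibniz expansion). [folklore] -/
private theorem totalDegree_det_le_card {σ ι : Type*} [Fintype ι] [DecidableEq ι]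
    (N : Matrix ι ι (MvPolynomial σ ℂ)) (h : ∀ i j, (N i j).totalDegree ≤ 1) :
    N.det.totalDegree ≤ Fintype.card ι := by
  rw [Matrix.det_apply']
  refine MvPolynomial.totalDegree_finsetSum_le fun τ _ => ?_
  refine (MvPolynomial.totalDegree_mul _ _).trans ?_
  have h1 : (((Equiv.Perm.sign τ : ℤˣ) : ℤ) : MvPolynomial σ ℂ).totalDegree = 0 := by
    rw [← map_intCast (MvPolynomial.C : ℂ →+* MvPolynomial σ ℂ), MvPolynomial.totalDegree_C]
  rw [h1, zero_add]
  refine (MvPolynomial.totalDegree_finsetProd _ _).trans ?_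
  calc ∑ i, (N (τ i) i).totalDegree ≤ ∑ _i : ι, 1 := Finset.sum_le_sum fun i _ => h _ _
    _ = Fintype.card ι := by simp

/-- The approximants `n! · det (1 + diag(x ∘ κ) K)` have total degree `≤ R`, hence are supported in the finite
box of monomials of degree `≤ R`. [folklore] -/
theorem support_approximant_subset (n R : ℕ) (κ : Fin R → Fin n × Fin n) (K : Matrix (Fin R) (Fin R) ℂ) :
    (C (n.factorial : ℂ) * (1 + diagonal (fun i => X (κ i)) *
      K.map (fun a : ℂ => (C a : MvPolynomial (Fin n × Fin n) ℂ))).det).support ⊆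
      (Finset.range (R + 1)).biUnion (fun d => (Finset.univ : Finset (Fin n × Fin n)).finsuppAntidiag d) := by
  classical
  refine support_subset_degBox_of_totalDegree_le ((totalDegree_mul _ _).trans ?_)
  rw [totalDegree_C, zero_add]
  refine (totalDegree_det_le_card _ fun i j => ?_).trans (by simp)
  rw [Matrix.add_apply, diagonal_mul, Matrix.map_apply]
  refine (totalDegree_add _ _).trans (max_le ?_ ?_)
  · rw [Matrix.one_apply]
    split_ifs <;> simp
  · refine (totalDegree_mul _ _).trans ?_
    rw [totalDegree_X, totalDegree_C]

/-- **Stub `stub_transport` of line `closure_counting` (registered signature, by name) — closure transport to the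
normal-form image.** If the coefficient vector of `per_n(x+J)` is in the closure of the coefficient vectors of
`n!·det(I_R + diag(x∘κ)K)` (classes of `κ` of size `≤ 2`), then for every injective placement `ζ` of `k`
variables and every substitution `S` of constants outside `ζ`, the `2^k` coefficients `c` of
`S(per_n) = Σ_h c_h ∏_{h i} X_{ζ i}` lie in `closure (NFImage k)`.  Proof: substitute `X_{ζ i} ↦ X_i - 1` and
`x_e ↦ S(e) - 1` elsewhere (`T`), a linear map on polynomials; the approximants have total degree `≤ R`, so on
their coefficient functions `g ↦ (coeff_{monB h} (T g))_h` is a finite sum of coordinate functionals, continuous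
in the product topology, and the limit passes (`coeff_linearMap_mem_closure`); `T` of an approximant is
`n!·det(1 + diag(d) K)` with `d_j = β_j + [κ j = ζ i] X_i`, at most `2k` variable slots, which Hrubeš–Joglekar's
Lemma 1 puts in normal form (`coeff_det_one_add_diagonal_mul_mem_NFImage`); and `rename ζ (T P) = S(per_n)`
identifies the limit's coefficients with `c`. [cite: HrubesJoglekar2025, Lemma 1 (p. 53:3)] -/
theorem stub_transport :
    ∀ (n R : ℕ) (κ : Fin R → Fin n × Fin n), (∀ e, (Finset.univ.filter (fun i => κ i = e)).card ≤ 2) →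
      (fun m : (Fin n × Fin n) →₀ ℕ => MvPolynomial.coeff m (MvPolynomial.aeval (fun e => MvPolynomial.X e + 1)
          (Literature.Computability.AlgebraicComplexity.perPoly (Fin n) ℂ))) ∈
        closure (Set.range (fun K : Matrix (Fin R) (Fin R) ℂ => fun m : (Fin n × Fin n) →₀ ℕ =>
          MvPolynomial.coeff m (MvPolynomial.C (n.factorial : ℂ) * (1 + Matrix.diagonal (fun i => MvPolynomial.X (κ i)) *
            K.map (fun a : ℂ => (MvPolynomial.C a : MvPolynomial (Fin n × Fin n) ℂ))).det))) →
      ∀ (k : ℕ) (ζ : Fin k → Fin n × Fin n), Function.Injective ζ →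
      ∀ (S : Fin n × Fin n → MvPolynomial (Fin n × Fin n) ℂ) (c : (Fin k → Bool) → ℂ),
        (∀ i, S (ζ i) = X (ζ i)) → (∀ e, (∀ i, ζ i ≠ e) → ∃ a, S e = C a) →
        aeval S (perPoly (Fin n) ℂ) = ∑ h : Fin k → Bool, C (c h) * ∏ i, (if h i then X (ζ i) else 1) →
        c ∈ closure (NFImage k) := by
  intro n R κ hκ hv k ζ hζ S c hS1 hS2 hS3
  classical
  -- notation: the limit `P = per_n(x+J)` and the approximants `Q K`
  set P : MvPolynomial (Fin n × Fin n) ℂ := aeval (fun e => X e + 1) (perPoly (Fin n) ℂ) with hP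
  set Q : Matrix (Fin R) (Fin R) ℂ → MvPolynomial (Fin n × Fin n) ℂ := fun K =>
    C (n.factorial : ℂ) * (1 + diagonal (fun i => X (κ i)) *
      K.map (fun a : ℂ => (C a : MvPolynomial (Fin n × Fin n) ℂ))).det with hQ
  -- the substitution into `k` abstract variables: `X (ζ i) ↦ X i - 1`, every other `x_e ↦ S e - 1`
  obtain ⟨γ, hγ⟩ : ∃ γ : Fin n × Fin n → ℂ,
      γ = fun e => (if ∃ i, ζ i = e then 0 else coeff 0 (S e)) - 1 := ⟨_, rfl⟩
  obtain ⟨T, hT⟩ : ∃ T : Fin n × Fin n → MvPolynomial (Fin k) ℂ,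
      T = fun e => C (γ e) + ∑ i, (if ζ i = e then (X i : MvPolynomial (Fin k) ℂ) else 0) := ⟨_, rfl⟩
  -- (1) `rename ζ ∘ T = S - 1`
  have hTS : ∀ e, rename ζ (T e) = S e - 1 := by
    intro e
    by_cases he : ∃ i, ζ i = e
    · obtain ⟨i, rfl⟩ := he
      have hsum : (∑ i', (if ζ i' = ζ i then (X i' : MvPolynomial (Fin k) ℂ) else 0)) = X i := by
        simp_rw [hζ.eq_iff]
        rw [Finset.sum_ite_eq' Finset.univ i, if_pos (Finset.mem_univ _)]
      have hex : ∃ i', ζ i' = ζ i := ⟨i, rfl⟩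
      simp only [hT, hγ, if_pos hex, hsum, map_add, rename_X, hS1, zero_sub, map_neg, map_one]
      ring
    · have hsum : (∑ i', (if ζ i' = e then (X i' : MvPolynomial (Fin k) ℂ) else 0)) = 0 :=
        Finset.sum_eq_zero fun i' _ => if_neg fun h => he ⟨i', h⟩
      obtain ⟨a, ha⟩ := hS2 e fun i h => he ⟨i, h⟩
      simp only [hT, hγ, if_neg he, hsum, add_zero, rename_C, ha, coeff_zero_C, map_sub, map_one]
  -- (2) `rename ζ (T P) = S(per_n)`
  have hren : rename ζ (aeval T P) = ∑ h : Fin k → Bool, C (c h) * ∏ i, (if h i then X (ζ i) else 1) := by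
    rw [← hS3]
    have h1 : rename ζ (aeval T P) = aeval (fun e => S e - 1) P := by
      rw [← AlgHom.comp_apply, comp_aeval,
        show (fun e => rename ζ (T e)) = (fun e => S e - 1) from funext hTS]
    have h2 : (fun e => aeval (fun e => S e - 1) (X e + 1 : MvPolynomial (Fin n × Fin n) ℂ)) = S := by
      funext e
      simp
    rw [h1, hP, ← AlgHom.comp_apply, comp_aeval, h2]
  -- (3) the coefficients of `T P` at the multilinear monomials are the `c h`
  have hc : c = fun h => coeff (monB h) ((aeval T).toLinearMap P) := by
    funext h
    rw [AlgHom.toLinearMap_apply, ← coeff_rename_mapDomain ζ hζ, hren]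
    have hmon : Finsupp.mapDomain ζ (monB h) =
        ∑ i ∈ Finset.univ.filter (fun i => h i = true), Finsupp.single (ζ i) 1 := by
      rw [monB, Finsupp.mapDomain_finsetSum]
      simp_rw [Finsupp.mapDomain_single]
    rw [hmon, coeff_sum_C_mul_prod_ite_X ζ hζ c h]
  -- (4) the approximants are supported in the degree-`R` box
  have hsupp : ∀ g ∈ Set.range Q, g.support ⊆
      (Finset.range (R + 1)).biUnion (fun d => (Finset.univ : Finset (Fin n × Fin n)).finsuppAntidiag d) := by
    rintro _ ⟨K, rfl⟩
    exact support_approximant_subset n R κ K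
  -- (5) `T` of an approximant is in normal form
  have hU : ∀ g ∈ Set.range Q, (fun h => coeff (monB h) ((aeval T).toLinearMap g)) ∈ NFImage k := by
    rintro _ ⟨K, rfl⟩
    -- the variable slots: pairs `(i, j)` with `κ j = ζ i`; at most two `j` per `i`
    have hcard : Fintype.card (Σ i : Fin k, {j : Fin R // κ j = ζ i}) ≤ 2 * k := by
      rw [Fintype.card_sigma]
      calc ∑ i, Fintype.card {j : Fin R // κ j = ζ i}
          ≤ ∑ _i : Fin k, 2 := Finset.sum_le_sum fun i _ => by
            rw [Fintype.card_subtype]; exact hκ (ζ i)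
        _ = 2 * k := by simp [mul_comm]
    have hslots : ∀ j : Fin R, (∑ i, (if ζ i = κ j then (X i : MvPolynomial (Fin k) ℂ) else 0)) =
        ∑ q : (Σ i : Fin k, {j : Fin R // κ j = ζ i}), (if (q.2 : Fin R) = j then X q.1 else 0) := by
      intro j
      rw [Fintype.sum_sigma]
      refine Finset.sum_congr rfl fun i _ => ?_
      by_cases hij : κ j = ζ i
      · rw [if_pos hij.symm, Finset.sum_eq_single ⟨j, hij⟩]
        · simp
        · intro j' _ hj'
          exact if_neg fun h => hj' (Subtype.ext h)
        · intro h
          exact absurd (Finset.mem_univ _) h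
      · rw [if_neg (fun h => hij h.symm)]
        refine (Finset.sum_eq_zero fun j' _ => if_neg fun h => hij ?_).symm
        rw [← h]
        exact j'.2
    have hslot : ∀ j : Fin R, T (κ j) = C (γ (κ j)) +
        ∑ q : (Σ i : Fin k, {j : Fin R // κ j = ζ i}),
          (if (fun q : (Σ i : Fin k, {j : Fin R // κ j = ζ i}) => (q.2 : Fin R)) q = j then
            (X ((fun q : (Σ i : Fin k, {j : Fin R // κ j = ζ i}) => q.1) q) : MvPolynomial (Fin k) ℂ) else 0) := by
      intro j
      rw [hT]
      dsimp only
      rw [hslots j]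
    have h1 : (fun j => aeval T (X (κ j) : MvPolynomial (Fin n × Fin n) ℂ)) = fun j => T (κ j) := by
      funext j
      simp only [aeval_X]
    have h2 : ((aeval T : MvPolynomial (Fin n × Fin n) ℂ → MvPolynomial (Fin k) ℂ) ∘
        fun a : ℂ => (C a : MvPolynomial (Fin n × Fin n) ℂ)) = fun a : ℂ => (C a : MvPolynomial (Fin k) ℂ) :=
      funext fun a => by simp
    have haeval : aeval T (Q K) = C (n.factorial : ℂ) * (1 + diagonal (fun j => T (κ j)) *
          K.map (fun a : ℂ => (C a : MvPolynomial (Fin k) ℂ))).det := by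
      rw [hQ]
      dsimp only
      rw [map_mul, aeval_C, MvPolynomial.algebraMap_eq, AlgHom.map_det, map_add, map_one, map_mul,
        AlgHom.mapMatrix_apply, AlgHom.mapMatrix_apply, diagonal_map (map_zero _), Matrix.map_map, h1, h2]
    rw [AlgHom.toLinearMap_apply, haeval]
    exact coeff_det_one_add_diagonal_mul_mem_NFImage (Q := Σ i : Fin k, {j : Fin R // κ j = ζ i}) K
      (fun j => T (κ j)) (fun j => γ (κ j)) (fun q => (q.2 : Fin R)) (fun q => q.1) (n.factorial : ℂ)
      hslot hcard
  -- (6) the hypothesis in the shape of `coeff_linearMap_mem_closure`, and the transport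
  have hf : (fun m => coeff m P) ∈ closure ((fun g : MvPolynomial (Fin n × Fin n) ℂ => fun m => coeff m g) ''
      Set.range Q) := by
    rw [← Set.range_comp]
    exact hv
  rw [hc]
  exact (coeff_linearMap_mem_closure (aeval T).toLinearMap monB hsupp hf hU).2

end Summit.ValiantsHypothesis.ValiantsHypothesis.Theorems.BorderBoundedRankTwoClosureCounting
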